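import Mathlib.Algebra.Order.ToIntervalMod
import Mathlib.Analysis.SpecialFunctions.Trigonometric.Basic
import Mathlib.Data.Finset.Max
import HarnessLib

/-!
# Boundary budget, unit BB6: cyclic monotonicity of angles from quadruple betweenness
(witness unit U6 of line `slit-necklace`)

Crux `SAWLeftRightFKG.FKGToTraversalBound` (stmt-CriticalPhenomena-1878), line `slit-necklace`, lead
prover-line-stmt-CriticalPhenomena-1878-c5-0; wave 6 (the BOUNDARY BUDGET `BoundaryBudget`), unit BB6, registered
stub `bb_cyclic_windows`.  Pure combinatorics on real numbers, Mathlib only.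

`ψ 0, …, ψ (2q-1)` are pairwise distinct angles in `[0, 2π)` (feet of facing edges along the boundary circle, listed
in tour order); the consecutive pairs `(ψ (2m), ψ (2m+1))`, `m < q`, are the `q` windows.  QUADRUPLE BETWEENNESS: for
indices `i < j < k < l < 2q`, reading `ψ j, ψ k, ψ l` in the window `(ψ i, ψ i + 2π]` (`toIocMod`), the representative
of `ψ k` lies strictly between those of `ψ j` and `ψ l` (the chords `{i, k}` and `{j, l}` cross).  CLAIM
(`bb_cyclic_windows`): at least `q - 2` of the windows, each read in increasing order, are pairwise disjoint increasing
sub-intervals of `[0, 2π)`.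

Proof.  For two distinct angles `a, x ∈ [0, p)` the representative `toIocMod a x` is `x` if `a < x` and `x + p` if
`x < a` (`bbw_toIocMod_of_lt/gt`).  Let `r` be the index of the minimal angle.  Reading the hypothesis for a quadruple
containing `r` in each of the four possible positions (`bbw_base_min`, `bbw_second_min`, `bbw_third_min`,
`bbw_fourth_min`: elementary case analyses) shows that along the ROTATED positions `n ↦ ψ (r + n mod 2q)`,
`1 ≤ n < 2q`, every middle term of every triple lies strictly between the outer two (`bbw_between`); such a finite
sequence is strictly monotone (`bbw_mono`).  The windows are pairs of consecutive rotated positions (all but the one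
containing `r`), so `q - 1` of them, enumerated by increasing (resp. decreasing) rotated position, are disjoint and
increasing (`bbw_windows`).

All statements folklore; no literature fact is introduced; nothing restates the crux; only theorems.
-/

noncomputable section

namespace Summit.CriticalPhenomena.SAWScalingLimit.Theorems.FKGToTraversalBound.SlitNecklace

/-- The representative of `x ∈ [0, p)` in the window `(a, a + p]` is `x` itself when `a < x` (`0 ≤ a`). -/
theorem bbw_toIocMod_of_lt {p a x : ℝ} (hp : 0 < p) (h0a : 0 ≤ a) (hax : a < x) (hx : x < p) :
    toIocMod hp a x = x :=
  (toIocMod_eq_self hp).2 ⟨hax, by linarith⟩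

/-- The representative of `x ∈ [0, p)` in the window `(a, a + p]` is `x + p` when `x < a < p`. -/
theorem bbw_toIocMod_of_gt {p a x : ℝ} (hp : 0 < p) (h0x : 0 ≤ x) (hxa : x < a) (ha : a < p) :
    toIocMod hp a x = x + p := by
  rw [← toIocMod_add_right hp a x]
  exact (toIocMod_eq_self hp).2 ⟨by linarith, by linarith⟩

/-- Quadruple betweenness with the base angle `a` minimal: the raw angles `b, c, d` are monotone. -/
theorem bbw_base_min {p a b c d : ℝ} (hp : 0 < p) (h0a : 0 ≤ a) (hab : a < b) (hac : a < c)
    (had : a < d) (hb : b < p) (hc : c < p) (hd : d < p)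
    (H : (toIocMod hp a b < toIocMod hp a c ∧ toIocMod hp a c < toIocMod hp a d) ∨
      (toIocMod hp a d < toIocMod hp a c ∧ toIocMod hp a c < toIocMod hp a b)) :
    (b < c ∧ c < d) ∨ (d < c ∧ c < b) := by
  rwa [bbw_toIocMod_of_lt hp h0a hab hb, bbw_toIocMod_of_lt hp h0a hac hc,
    bbw_toIocMod_of_lt hp h0a had hd] at H

/-- Quadruple betweenness (base `a`, then `b, c, d`) with the SECOND angle `b` minimal: reading cyclically from
`b`, the raw angles `c, d, a` are monotone. -/
theorem bbw_second_min {p a b c d : ℝ} (hp : 0 < p) (h0b : 0 ≤ b) (hba : b < a) (hbc : b < c)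
    (hbd : b < d) (ha : a < p) (hc : c < p) (hd : d < p) (hac : a ≠ c) (had : a ≠ d)
    (H : (toIocMod hp a b < toIocMod hp a c ∧ toIocMod hp a c < toIocMod hp a d) ∨
      (toIocMod hp a d < toIocMod hp a c ∧ toIocMod hp a c < toIocMod hp a b)) :
    (c < d ∧ d < a) ∨ (a < d ∧ d < c) := by
  rw [bbw_toIocMod_of_gt hp h0b hba ha] at H
  rcases lt_or_gt_of_ne hac with hac | hca
  · rw [bbw_toIocMod_of_lt hp (by linarith) hac hc] at H
    rcases lt_or_gt_of_ne had with had | hda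
    · rw [bbw_toIocMod_of_lt hp (by linarith) had hd] at H
      obtain h | h := H
      · exfalso; linarith [h.1]
      · exact Or.inr ⟨had, h.1⟩
    · rw [bbw_toIocMod_of_gt hp (by linarith) hda ha] at H
      obtain h | h := H
      · exfalso; linarith [h.1]
      · exfalso; linarith [h.1]
  · rw [bbw_toIocMod_of_gt hp (by linarith) hca ha] at H
    rcases lt_or_gt_of_ne had with had | hda
    · rw [bbw_toIocMod_of_lt hp (by linarith) had hd] at H
      obtain h | h := H
      · exfalso; linarith [h.2]
      · exfalso; linarith [h.2]
    · rw [bbw_toIocMod_of_gt hp (by linarith) hda ha] at H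
      obtain h | h := H
      · exact Or.inl ⟨by linarith [h.2], hda⟩
      · exfalso; linarith [h.2]

/-- Quadruple betweenness (base `a`, then `b, c, d`) with the THIRD angle `c` minimal: reading cyclically from
`c`, the raw angles `d, a, b` are monotone. -/
theorem bbw_third_min {p a b c d : ℝ} (hp : 0 < p) (h0c : 0 ≤ c) (hca : c < a) (hcb : c < b)
    (hcd : c < d) (ha : a < p) (hb : b < p) (hd : d < p) (hab : a ≠ b) (had : a ≠ d)
    (H : (toIocMod hp a b < toIocMod hp a c ∧ toIocMod hp a c < toIocMod hp a d) ∨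
      (toIocMod hp a d < toIocMod hp a c ∧ toIocMod hp a c < toIocMod hp a b)) :
    (b < a ∧ a < d) ∨ (d < a ∧ a < b) := by
  rw [bbw_toIocMod_of_gt hp h0c hca ha] at H
  rcases lt_or_gt_of_ne hab with hab | hba
  · rw [bbw_toIocMod_of_lt hp (by linarith) hab hb] at H
    rcases lt_or_gt_of_ne had with had | hda
    · rw [bbw_toIocMod_of_lt hp (by linarith) had hd] at H
      obtain h | h := H
      · exfalso; linarith [h.2]
      · exfalso; linarith [h.2]
    · rw [bbw_toIocMod_of_gt hp (by linarith) hda ha] at H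
      obtain _ | h := H
      · exact Or.inr ⟨hda, hab⟩
      · exfalso; linarith [h.2]
  · rw [bbw_toIocMod_of_gt hp (by linarith) hba ha] at H
    rcases lt_or_gt_of_ne had with had | hda
    · rw [bbw_toIocMod_of_lt hp (by linarith) had hd] at H
      obtain h | _ := H
      · exfalso; linarith [h.1]
      · exact Or.inl ⟨hba, had⟩
    · rw [bbw_toIocMod_of_gt hp (by linarith) hda ha] at H
      obtain h | h := H
      · exfalso; linarith [h.1]
      · exfalso; linarith [h.1]

/-- Quadruple betweenness (base `a`, then `b, c, d`) with the FOURTH angle `d` minimal: reading cyclically from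
`d`, the raw angles `a, b, c` are monotone (from `bbw_second_min` by the symmetry `b ↔ d`). -/
theorem bbw_fourth_min {p a b c d : ℝ} (hp : 0 < p) (h0d : 0 ≤ d) (hda : d < a) (hdb : d < b)
    (hdc : d < c) (ha : a < p) (hb : b < p) (hc : c < p) (hab : a ≠ b) (hac : a ≠ c)
    (H : (toIocMod hp a b < toIocMod hp a c ∧ toIocMod hp a c < toIocMod hp a d) ∨
      (toIocMod hp a d < toIocMod hp a c ∧ toIocMod hp a c < toIocMod hp a b)) :
    (a < b ∧ b < c) ∨ (c < b ∧ b < a) :=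
  (bbw_second_min hp h0d hda hdc hdb ha hc hb hac hab H.symm).symm

/-- BETWEENNESS ALONG ROTATED POSITIONS.  `r` is the index of the minimal angle and `idx n` the index at rotated
position `n` (`r + n` reduced mod `2q`); for rotated positions `1 ≤ a < b < c < 2q` the angle at `b` lies strictly
between the angles at `a` and `c`.  The four cases (how many of the three indices wrap around) are read off the
quadruple-betweenness hypothesis for the sorted quadruple `{r, idx a, idx b, idx c}`, in which `r` occupies the
first, second, third or fourth place. -/
theorem bbw_between (q r : ℕ) (ψ : ℕ → ℝ) (idx : ℕ → ℕ) (hr : r < 2 * q)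
    (hbd : ∀ i, i < 2 * q → 0 ≤ ψ i ∧ ψ i < 2 * Real.pi)
    (hne : ∀ x y, x < 2 * q → y < 2 * q → x ≠ y → ψ x ≠ ψ y)
    (hmin : ∀ x, x < 2 * q → x ≠ r → ψ r < ψ x)
    (hyp : ∀ i j k l, i < j → j < k → k < l → l < 2 * q →
      ((toIocMod Real.two_pi_pos (ψ i) (ψ j) < toIocMod Real.two_pi_pos (ψ i) (ψ k) ∧
        toIocMod Real.two_pi_pos (ψ i) (ψ k) < toIocMod Real.two_pi_pos (ψ i) (ψ l)) ∨
      (toIocMod Real.two_pi_pos (ψ i) (ψ l) < toIocMod Real.two_pi_pos (ψ i) (ψ k) ∧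
        toIocMod Real.two_pi_pos (ψ i) (ψ k) < toIocMod Real.two_pi_pos (ψ i) (ψ j))))
    (h1 : ∀ n, r + n < 2 * q → idx n = r + n) (h2 : ∀ n, 2 * q ≤ r + n → idx n = r + n - 2 * q) :
    ∀ a b c, 1 ≤ a → a < b → b < c → c < 2 * q →
      (ψ (idx a) < ψ (idx b) ∧ ψ (idx b) < ψ (idx c)) ∨
        (ψ (idx c) < ψ (idx b) ∧ ψ (idx b) < ψ (idx a)) := by
  intro a b c ha hab hbc hc
  have h0r : 0 ≤ ψ r := (hbd r hr).1
  by_cases hC : r + c < 2 * q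
  · -- no wrap-around: `r < r + a < r + b < r + c`, the minimum comes first
    rw [h1 a (by omega), h1 b (by omega), h1 c hC]
    exact bbw_base_min Real.two_pi_pos h0r (hmin _ (by omega) (by omega)) (hmin _ (by omega) (by omega))
      (hmin _ hC (by omega)) (hbd _ (by omega)).2 (hbd _ (by omega)).2 (hbd _ hC).2
      (hyp r (r + a) (r + b) (r + c) (by omega) (by omega) (by omega) hC)
  by_cases hB : r + b < 2 * q
  · -- `c` wraps: `r + c - 2q < r < r + a < r + b`, the minimum comes second
    rw [h1 a (by omega), h1 b hB, h2 c (by omega)]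
    exact bbw_second_min Real.two_pi_pos h0r (hmin _ (by omega) (by omega))
      (hmin _ (by omega) (by omega)) (hmin _ hB (by omega)) (hbd _ (by omega)).2 (hbd _ (by omega)).2
      (hbd _ hB).2 (hne _ _ (by omega) (by omega) (by omega)) (hne _ _ (by omega) (by omega) (by omega))
      (hyp (r + c - 2 * q) r (r + a) (r + b) (by omega) (by omega) (by omega) hB)
  by_cases hA : r + a < 2 * q
  · -- `b, c` wrap: `r + b - 2q < r + c - 2q < r < r + a`, the minimum comes third
    rw [h1 a hA, h2 b (by omega), h2 c (by omega)]
    exact (bbw_third_min Real.two_pi_pos h0r (hmin _ (by omega) (by omega))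
      (hmin _ (by omega) (by omega)) (hmin _ hA (by omega)) (hbd _ (by omega)).2 (hbd _ (by omega)).2
      (hbd _ hA).2 (hne _ _ (by omega) (by omega) (by omega)) (hne _ _ (by omega) (by omega) (by omega))
      (hyp (r + b - 2 * q) (r + c - 2 * q) r (r + a) (by omega) (by omega) (by omega) hA)).symm
  · -- all wrap: `r + a - 2q < r + b - 2q < r + c - 2q < r`, the minimum comes last
    rw [h2 a (by omega), h2 b (by omega), h2 c (by omega)]
    exact bbw_fourth_min Real.two_pi_pos h0r (hmin _ (by omega) (by omega))
      (hmin _ (by omega) (by omega)) (hmin _ (by omega) (by omega)) (hbd _ (by omega)).2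
      (hbd _ (by omega)).2 (hbd _ (by omega)).2 (hne _ _ (by omega) (by omega) (by omega))
      (hne _ _ (by omega) (by omega) (by omega))
      (hyp (r + a - 2 * q) (r + b - 2 * q) (r + c - 2 * q) r (by omega) (by omega) (by omega) hr)

/-- A finite real sequence on `[lo, hi)` in which every middle term of every triple lies strictly between the
outer two, and whose first step goes up, is strictly increasing. -/
theorem bbw_mono_inc (φ : ℕ → ℝ) (lo hi : ℕ) (hlt : φ lo < φ (lo + 1))
    (hbet : ∀ a b c, lo ≤ a → a < b → b < c → c < hi →
      (φ a < φ b ∧ φ b < φ c) ∨ (φ c < φ b ∧ φ b < φ a)) :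
    ∀ a b, lo ≤ a → a < b → b < hi → φ a < φ b := by
  have aux : ∀ b, lo < b → b < hi → φ lo < φ b := by
    intro b hb hbhi
    rcases Nat.lt_or_ge (lo + 1) b with h | h
    · rcases hbet lo (lo + 1) b le_rfl (Nat.lt_succ_self lo) h hbhi with ⟨_, h2⟩ | ⟨_, h2⟩
      · exact hlt.trans h2
      · exact absurd hlt (not_lt.mpr h2.le)
    · obtain rfl : b = lo + 1 := by omega
      exact hlt
  intro a b hloa hab hbhi
  rcases Nat.lt_or_ge lo a with h | h
  · have hla := aux a h (by omega)
    rcases hbet lo a b le_rfl h hab hbhi with ⟨_, h2⟩ | ⟨_, h2⟩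
    · exact h2
    · exact absurd hla (not_lt.mpr h2.le)
  · obtain rfl : a = lo := by omega
    exact aux b hab hbhi

/-- A finite real sequence on `[lo, hi)` with distinct first two terms in which every middle term of every triple
lies strictly between the outer two is strictly monotone: increasing or decreasing. -/
theorem bbw_mono (φ : ℕ → ℝ) (lo hi : ℕ) (hne : lo + 1 < hi → φ lo ≠ φ (lo + 1))
    (hbet : ∀ a b c, lo ≤ a → a < b → b < c → c < hi →
      (φ a < φ b ∧ φ b < φ c) ∨ (φ c < φ b ∧ φ b < φ a)) :
    (∀ a b, lo ≤ a → a < b → b < hi → φ a < φ b) ∨ (∀ a b, lo ≤ a → a < b → b < hi → φ b < φ a) := by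
  by_cases h : lo + 1 < hi
  swap
  · exact Or.inl fun a b h₁ h₂ h₃ => absurd h₃ (by omega)
  rcases lt_or_gt_of_ne (hne h) with hlt | hgt
  · exact Or.inl (bbw_mono_inc φ lo hi hlt hbet)
  · right
    have key := bbw_mono_inc (fun n => -φ n) lo hi (neg_lt_neg hgt) (fun a b c h₁ h₂ h₃ h₄ => by
      show (-φ a < -φ b ∧ -φ b < -φ c) ∨ (-φ c < -φ b ∧ -φ b < -φ a)
      rcases hbet a b c h₁ h₂ h₃ h₄ with ⟨x, y⟩ | ⟨x, y⟩
      · exact Or.inr ⟨by linarith, by linarith⟩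
      · exact Or.inl ⟨by linarith, by linarith⟩)
    intro a b h₁ h₂ h₃
    have hk : -φ a < -φ b := key a b h₁ h₂ h₃
    exact neg_lt_neg_iff.mp hk

/-- WINDOW EXTRACTION.  If `g` is strictly increasing on the positions `[1, 2q)` with values in `[0, 2π)` and, for
an offset `c ∈ {1, 2}`, each pair of positions `(2i + c, 2i + c + 1)`, `i + 1 < q`, carries a window
`{ψ (2m), ψ (2m+1)}`, then these `q - 1` windows are pairwise disjoint increasing intervals. -/
theorem bbw_windows (q c : ℕ) (ψ g : ℕ → ℝ) (hc1 : 1 ≤ c) (hc2 : c ≤ 2)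
    (hg : ∀ a b, 1 ≤ a → a < b → b < 2 * q → g a < g b)
    (hrange : ∀ n, 1 ≤ n → n < 2 * q → 0 ≤ g n ∧ g n < 2 * Real.pi)
    (hwin : ∀ i, i + 1 < q → ∃ m, m < q ∧
      ((g (2 * i + c) = ψ (2 * m) ∧ g (2 * i + c + 1) = ψ (2 * m + 1)) ∨
        (g (2 * i + c) = ψ (2 * m + 1) ∧ g (2 * i + c + 1) = ψ (2 * m)))) :
    ∃ (k : ℕ) (s t : Fin k → ℝ), q ≤ k + 2 ∧ (∀ i, 0 ≤ s i ∧ s i < t i ∧ t i < 2 * Real.pi) ∧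
      (∀ ⦃i j : Fin k⦄, i < j → t i < s j) ∧
      (∀ i, ∃ m, m < q ∧ ((s i = ψ (2 * m) ∧ t i = ψ (2 * m + 1)) ∨
        (s i = ψ (2 * m + 1) ∧ t i = ψ (2 * m)))) := by
  refine ⟨q - 1, fun i => g (2 * i.1 + c), fun i => g (2 * i.1 + c + 1), by omega, ?_, ?_, ?_⟩
  · intro i
    have hi := i.2
    exact ⟨(hrange _ (by omega) (by omega)).1, hg _ _ (by omega) (by omega) (by omega),
      (hrange _ (by omega) (by omega)).2⟩
  · intro i j hij
    have hj := j.2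
    have hij' : i.1 < j.1 := hij
    exact hg _ _ (by omega) (by omega) (by omega)
  · intro i
    have hi := i.2
    exact hwin i.1 (by omega)

/-- **Cyclic monotonicity from quadruple betweenness** (boundary budget, unit BB6).  `2q` pairwise distinct
angles `ψ 0, …, ψ (2q-1)` in `[0, 2π)` with the quadruple-betweenness property (for `i < j < k < l < 2q`, read in
the window `(ψ i, ψ i + 2π]`, the angle `ψ k` lies strictly between `ψ j` and `ψ l`) contain `k ≥ q - 2` of the
`q` consecutive pairs `{ψ (2m), ψ (2m+1)}` as pairwise disjoint, increasing parameter windows `s i < t i` inside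
`[0, 2π)`, listed in increasing order (`t i < s j` for `i < j`). -/
theorem bb_cyclic_windows : ∀ (q : ℕ) (ψ : ℕ → ℝ), (∀ i, i < 2 * q → 0 ≤ ψ i ∧ ψ i < 2 * Real.pi) → (∀ i j, i < 2 * q → j < 2 * q → ψ i = ψ j → i = j) → (∀ i j k l, i < j → j < k → k < l → l < 2 * q → ((toIocMod Real.two_pi_pos (ψ i) (ψ j) < toIocMod Real.two_pi_pos (ψ i) (ψ k) ∧ toIocMod Real.two_pi_pos (ψ i) (ψ k) < toIocMod Real.two_pi_pos (ψ i) (ψ l)) ∨ (toIocMod Real.two_pi_pos (ψ i) (ψ l) < toIocMod Real.two_pi_pos (ψ i) (ψ k) ∧ toIocMod Real.two_pi_pos (ψ i) (ψ k) < toIocMod Real.two_pi_pos (ψ i) (ψ j)))) → ∃ (k : ℕ) (s t : Fin k → ℝ), q ≤ k + 2 ∧ (∀ i, 0 ≤ s i ∧ s i < t i ∧ t i < 2 * Real.pi) ∧ (∀ ⦃i j : Fin k⦄, i < j → t i < s j) ∧ (∀ i, ∃ m, m < q ∧ ((s i = ψ (2 * m) ∧ t i = ψ (2 * m + 1)) ∨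 (s i = ψ (2 * m + 1) ∧ t i = ψ (2 * m)))) := by
  intro q ψ hbd hinj hyp
  rcases Nat.eq_zero_or_pos q with hq | hq
  · subst hq
    exact ⟨0, Fin.elim0, Fin.elim0, Nat.zero_le _, fun i => i.elim0, fun i => i.elim0, fun i => i.elim0⟩
  -- the index `r` of the minimal angle
  obtain ⟨r, hr, hrmin⟩ :=
    Finset.exists_min_image (Finset.range (2 * q)) ψ ⟨0, Finset.mem_range.2 (by omega)⟩
  replace hr : r < 2 * q := Finset.mem_range.1 hr
  have hne : ∀ x y, x < 2 * q → y < 2 * q → x ≠ y → ψ x ≠ ψ y :=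
    fun x y hx hy hxy h => hxy (hinj x y hx hy h)
  have hmin : ∀ x, x < 2 * q → x ≠ r → ψ r < ψ x := fun x hx hxr =>
    lt_of_le_of_ne (hrmin x (Finset.mem_range.2 hx)) (hne r x hr hx (Ne.symm hxr))
  -- rotated positions: `idx n` is the index at position `n` after `r`
  obtain ⟨idx, h1, h2⟩ : ∃ idx : ℕ → ℕ, (∀ n, r + n < 2 * q → idx n = r + n) ∧
      (∀ n, 2 * q ≤ r + n → idx n = r + n - 2 * q) :=
    ⟨fun n => if r + n < 2 * q then r + n else r + n - 2 * q, fun n hn => if_pos hn,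
      fun n hn => if_neg (not_lt.mpr hn)⟩
  have hidx : ∀ n, n < 2 * q → idx n < 2 * q := by
    intro n hn
    by_cases h : r + n < 2 * q
    · rw [h1 n h]; exact h
    · rw [h2 n (not_lt.mp h)]; omega
  have hbet := bbw_between q r ψ idx hr hbd hne hmin hyp h1 h2
  have hne12 : 1 + 1 < 2 * q → ψ (idx 1) ≠ ψ (idx (1 + 1)) := by
    intro h12
    apply hne _ _ (hidx 1 (by omega)) (hidx (1 + 1) h12)
    by_cases h₁ : r + (1 + 1) < 2 * q
    · rw [h1 1 (by omega), h1 (1 + 1) h₁]; omega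
    · by_cases h₂ : r + 1 < 2 * q
      · rw [h1 1 h₂, h2 (1 + 1) (by omega)]; omega
      · rw [h2 1 (by omega), h2 (1 + 1) (by omega)]; omega
  rcases bbw_mono (fun n => ψ (idx n)) 1 (2 * q) hne12 hbet with hinc | hdec
  · -- increasing rotated sequence: windows at rotated positions `(2i + 2 - r % 2, 2i + 3 - r % 2)`
    refine bbw_windows q (2 - r % 2) ψ (fun n => ψ (idx n)) (by omega) (by omega) hinc
      (fun n _ hn => hbd _ (hidx n hn)) ?_
    intro i hi
    obtain ⟨m, hm, hA, hB⟩ : ∃ m, m < q ∧ idx (2 * i + (2 - r % 2)) = 2 * m ∧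
        idx (2 * i + (2 - r % 2) + 1) = 2 * m + 1 := by
      by_cases h : r + (2 * i + (2 - r % 2)) < 2 * q
      · refine ⟨(r + (2 * i + (2 - r % 2))) / 2, by omega, ?_, ?_⟩
        · rw [h1 _ h]; omega
        · rw [h1 _ (by omega)]; omega
      · refine ⟨(r + (2 * i + (2 - r % 2)) - 2 * q) / 2, by omega, ?_, ?_⟩
        · rw [h2 _ (by omega)]; omega
        · rw [h2 _ (by omega)]; omega
    exact ⟨m, hm, Or.inl ⟨congrArg ψ hA, congrArg ψ hB⟩⟩
  · -- decreasing rotated sequence: reverse the positions, windows read as `(ψ (2m+1), ψ (2m))`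
    refine bbw_windows q (1 + r % 2) ψ (fun n => ψ (idx (2 * q - n))) (by omega) (by omega) ?_ ?_ ?_
    · intro a b ha hab hb
      exact hdec (2 * q - b) (2 * q - a) (by omega) (by omega) (by omega)
    · intro n hn1 hn
      exact hbd _ (hidx _ (by omega))
    · intro i hi
      obtain ⟨m, hm, hA, hB⟩ : ∃ m, m < q ∧ idx (2 * q - (2 * i + (1 + r % 2) + 1)) = 2 * m ∧
          idx (2 * q - (2 * i + (1 + r % 2))) = 2 * m + 1 := by
        by_cases h : r + (2 * q - (2 * i + (1 + r % 2) + 1)) < 2 * q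
        · refine ⟨(r + (2 * q - (2 * i + (1 + r % 2) + 1))) / 2, by omega, ?_, ?_⟩
          · rw [h1 _ h]; omega
          · rw [h1 _ (by omega)]; omega
        · refine ⟨(r + (2 * q - (2 * i + (1 + r % 2) + 1)) - 2 * q) / 2, by omega, ?_, ?_⟩
          · rw [h2 _ (by omega)]; omega
          · rw [h2 _ (by omega)]; omega
      exact ⟨m, hm, Or.inr ⟨congrArg ψ hB, congrArg ψ hA⟩⟩

end Summit.CriticalPhenomena.SAWScalingLimit.Theorems.FKGToTraversalBound.SlitNecklace

end
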